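import Summits.BirchSwinnertonDyer.BirchSwinnertonDyer.Theorems.KolyvaginDepthDoorDepthTableRowKitPrint
import Summits.BirchSwinnertonDyer.BirchSwinnertonDyer.Theorems.KolyvaginDepthDoorDepthTableRowsOfPrint4
import Summits.BirchSwinnertonDyer.BirchSwinnertonDyer.Theorems.KolyvaginDepthDoorDepthTableRowsOfPrint5
import HarnessLib

/-!
# Route `KolyvaginDepthDoor` — DEPTH-TABLE rows `707a1` `(5, -19, 179)`, `794a1` `(5, -23, 89)`, `817a1` `(5, -8, 239)`, `997b1` `(5, -52, 199)`
# ON PRINT-STANDARD INPUTS: no McCallum leaf, no structure theorem, no twist point, no system — the bit at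
# ANY datum, (γ) [Gross 1991 Prop. 3.7 (2)] the only named input (crux `KolyvaginDepthSupply`,
# stmt-BirchSwinnertonDyer-21765) — part 3 of 4

Helper file (`--supports stmt-BirchSwinnertonDyer-21765 --as helper`); it closes nothing and BSD is
not proved by it.

g7's rows `C<label>.depthRow_<p>_neg<D>_<ℓ>_ofDatum` (files `…DepthTableRowsNoTwistOfDatum*`) read each row
off the kit OF A DATUM modulo FIVE named McCallum / Gross leaves (`h54 h43 h44 h53 h22`). This file
re-issues the same rows over the kit ON PRINT-STANDARD INPUTS `depthRow_print_of_datum_of_intModel_certificate`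
(file `…DepthTableRowKitPrint`): the sign law (Gross 5.4), McCallum's Lemma 5.3 and Prop. 2.2 are now
tree THEOREMS at level `p` (`…LeafSign`, `…LeafEigenLine`, `…LeafReciprocity`); Lemma 4.3 is PROVED on
the Kodaira–Néron cell (`…LeafLocal`, x11b3's ENDs), and the (KN_p) side condition of each row is
CERTIFIED IN THE KERNEL from the discriminant of its integer model (a `decide`-able table); Prop. 4.4
comes from the ONE remaining named input (γ) = `GrossLMS1991.prop37_2_frobeniusCongruence` (Gross 1991
Prop. 3.7 (2), cite-only) through `JET.prop44_of_frobeniusCongruence`. Each row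
`C<label>.depthRow_<p>_neg<D>_<ℓ>_print` takes ANY single datum `d : KolyvaginHeegnerData Dt β ι ℓ`
and its bit and concludes `corank_{ℤ_p} Ш(E)[p^∞] = 0`, `rank_ℤ E(ℚ) = 2`, `rank_ℤ E^{(D)}(ℚ) ≤ 1`,
`E(ℚ)[p] = 0`, `Ш(E/ℚ)[p] = 0`, `#Sel^(p)(E/ℚ) = p²`. CONDITIONAL on (γ) and the bit;
per-curve; BSD is not proved by it.
-/

set_option linter.dupNamespace false

noncomputable section

open scoped Classical NumberField

namespace Summit.BirchSwinnertonDyer.BirchSwinnertonDyer.Theorems.KolyvaginDepthDoor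

open Literature.NumberTheory.EllipticCurves Literature.NumberTheory.EllipticCurves.ModularForms
  Literature.NumberTheory.EllipticCurves.McCallum1991 WeierstrassCurve
open Summit.BirchSwinnertonDyer.BirchSwinnertonDyer.Rank2Observatory
open Summit.BirchSwinnertonDyer.BirchSwinnertonDyer.Rank1Residual

namespace C707a1

/-- **DEPTH-TABLE ROW`707a1`, `(p, d_K, ℓ) = (5, -19, 179)`, ON PRINT-STANDARD INPUTS — no McCallum
leaf, no structure theorem, no twist point, no system (bit at ANY datum).** For `E = 707a1`, ANY
imaginary quadratic `K` with `d_K = -19`, any frame `(Dt, β, ι)` and ANY single Kolyvagin–Heegner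
datum `d` of conductor `179`, granted the ONE Literature fact (γ) =
`GrossLMS1991.prop37_2_frobeniusCongruence` (Gross 1991 Prop. 3.7 (2), the Eichler–Shimura
congruence for Heegner points; cite-only): IF `d.kolyvaginClass _ 1 ≠ 0` (the row's bit), THEN
`corank_{ℤ_5} Ш(E)[5^∞] = 0`, `rank_ℤ E(ℚ) = 2`, `rank_ℤ E^{(-19)}(ℚ) ≤ 1`, `E(ℚ)[5] = 0`,
`Ш(E/ℚ)[5] = 0` and `#Sel^(5)(E/ℚ) = 5²` — the twin of `C707a1.depthRow_5_neg19_179_ofDatum` with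
its FIVE named McCallum / Gross leaves (`h54 h43 h44 h53 h22`) DELETED: the sign law, Lemma 5.3 and
Prop. 2.2 are tree theorems (`…LeafSign`, `…LeafEigenLine`, `…LeafReciprocity`), Lemma 4.3 is proved
on the Kodaira–Néron cell / taken from F1 (`…LeafLocal`), Prop. 4.4 comes from (γ)
(`JET.prop44_of_frobeniusCongruence`); the Kodaira–Néron side condition (KN_5) `5 ∤ ord_v(Δ_min)` at
the multiplicative places is CERTIFIED IN THE KERNEL from `Δ(E₀) = 4949` (`decide`-able table of
`depthRow_print_of_datum_of_intModel_certificate`), the additive clause is void (`5 ≠ 3`). Every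
other side condition is a kernel theorem of the tree (g2–g7 certificates). CONDITIONAL on (γ) and
the bit; per-curve; BSD is not proved by it. [cite: Kolyvagin1991MathAnn, Thm. 2.3] [cite:
GrossLMS1991, Prop. 3.7 (2), §5 (5.1), Prop. 6.2 (1)] [cite: McCallumLMS1991, §§2–5] [cite:
JetchevLauterStein2009, §3.6 (arXiv:0707.0032)] -/
theorem depthRow_5_neg19_179_print
    (h372 : GrossLMS1991.prop37_2_frobeniusCongruence)
    (K : Type) [Field K] [NumberField K] (hK : IsImaginaryQuadratic K)
    (hD : NumberField.discr K = -19) :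
    haveI := isElliptic_c707a1;
    haveI := isGloballyMinimal_c707a1;
    haveI : NeZero (((⟨0, 1, 1, -12, 12⟩ : WeierstrassCurve ℤ).map (Int.castRingHom ℚ)).conductorNorm ℤ) :=
      neZero_conductorNorm_of_isElliptic _;
    ∀ (Dt : ModularParametrizationData ((⟨0, 1, 1, -12, 12⟩ : WeierstrassCurve ℤ).map (Int.castRingHom ℚ))
        (((⟨0, 1, 1, -12, 12⟩ : WeierstrassCurve ℤ).map (Int.castRingHom ℚ)).conductorNorm ℤ)) (β : ℤ)
      (ι : K →+* ℂ) (d : KolyvaginHeegnerData Dt β ι 179),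
    d.kolyvaginClass (p := 5) (by norm_num) 1 ≠ 0 →
    ((⟨0, 1, 1, -12, 12⟩ : WeierstrassCurve ℤ).map (Int.castRingHom ℚ)).shaCorank 5 = 0 ∧
      ((⟨0, 1, 1, -12, 12⟩ : WeierstrassCurve ℤ).map (Int.castRingHom ℚ)).mordellWeilRank = 2 ∧
      (((⟨0, 1, 1, -12, 12⟩ : WeierstrassCurve ℤ).map (Int.castRingHom ℚ)).quadraticTwist
        ((-19 : ℤ) : ℚ)).mordellWeilRank ≤ 1 ∧
      (∀ P : ((⟨0, 1, 1, -12, 12⟩ : WeierstrassCurve ℤ).map (Int.castRingHom ℚ)).toAffine.Point,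
        5 • P = 0 → P = 0) ∧
      (∀ x ∈ ((⟨0, 1, 1, -12, 12⟩ : WeierstrassCurve ℤ).map (Int.castRingHom ℚ)).sha, 5 • x = 0 → x = 0) ∧
      Nat.card ↥(selmerGroup ((⟨0, 1, 1, -12, 12⟩ : WeierstrassCurve ℤ).map (Int.castRingHom ℚ))
        ((5 : ℕ) : ℤ)) = 5 ^ 2 := by
  haveI := isElliptic_c707a1
  haveI := isGloballyMinimal_c707a1
  haveI : NeZero (((⟨0, 1, 1, -12, 12⟩ : WeierstrassCurve ℤ).map (Int.castRingHom ℚ)).conductorNorm ℤ) :=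
    neZero_conductorNorm_of_isElliptic _
  intro Dt β ι d hne
  haveI := Fact.mk (by norm_num : Nat.Prime 5)
  exact depthRow_print_of_datum_of_intModel_certificate intModel h372 not_hasCM
    KernelCerts002.C707a1.two_le_rank 5 (by norm_num) hasSurjectiveModNGaloisRep_pow_5 K hK hD
    (by norm_num) (by norm_num) heegner_neg19 179 (by norm_num) (by norm_num) (by decide +kernel)
    (by norm_num) (by norm_num) (by norm_num) (by norm_num) (n := 200) card_179 (by norm_num)
    (Δ₀ := 4949) (by decide +kernel) (B := 11) (by decide +kernel) (by decide +kernel)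
    (fun _ _ ↦ Or.inl (by norm_num)) Dt β ι d hne

end C707a1

namespace C794a1

/-- **DEPTH-TABLE ROW`794a1`, `(p, d_K, ℓ) = (5, -23, 89)`, ON PRINT-STANDARD INPUTS — no McCallum leaf,
no structure theorem, no twist point, no system (bit at ANY datum).** For `E = 794a1`, ANY imaginary
quadratic `K` with `d_K = -23`, any frame `(Dt, β, ι)` and ANY single Kolyvagin–Heegner datum `d` of
conductor `89`, granted the ONE Literature fact (γ) = `GrossLMS1991.prop37_2_frobeniusCongruence`
(Gross 1991 Prop. 3.7 (2), the Eichler–Shimura congruence for Heegner points; cite-only): IF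
`d.kolyvaginClass _ 1 ≠ 0` (the row's bit), THEN `corank_{ℤ_5} Ш(E)[5^∞] = 0`, `rank_ℤ E(ℚ) = 2`,
`rank_ℤ E^{(-23)}(ℚ) ≤ 1`, `E(ℚ)[5] = 0`, `Ш(E/ℚ)[5] = 0` and `#Sel^(5)(E/ℚ) = 5²` — the twin of
`C794a1.depthRow_5_neg23_89_ofDatum` with its FIVE named McCallum / Gross leaves (`h54 h43 h44 h53
h22`) DELETED: the sign law, Lemma 5.3 and Prop. 2.2 are tree theorems (`…LeafSign`,
`…LeafEigenLine`, `…LeafReciprocity`), Lemma 4.3 is proved on the Kodaira–Néron cell / taken from F1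
(`…LeafLocal`), Prop. 4.4 comes from (γ) (`JET.prop44_of_frobeniusCongruence`); the Kodaira–Néron
side condition (KN_5) `5 ∤ ord_v(Δ_min)` at the multiplicative places is CERTIFIED IN THE KERNEL
from `Δ(E₀) = -1588` (`decide`-able table of `depthRow_print_of_datum_of_intModel_certificate`), the
additive clause is void (`5 ≠ 3`). Every other side condition is a kernel theorem of the tree (g2–g7
certificates). CONDITIONAL on (γ) and the bit; per-curve; BSD is not proved by it. [cite:
Kolyvagin1991MathAnn, Thm. 2.3] [cite: GrossLMS1991, Prop. 3.7 (2), §5 (5.1), Prop. 6.2 (1)] [cite: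
McCallumLMS1991, §§2–5] [cite: JetchevLauterStein2009, §3.6 (arXiv:0707.0032)] -/
theorem depthRow_5_neg23_89_print
    (h372 : GrossLMS1991.prop37_2_frobeniusCongruence)
    (K : Type) [Field K] [NumberField K] (hK : IsImaginaryQuadratic K)
    (hD : NumberField.discr K = -23) :
    haveI := isElliptic_c794a1;
    haveI := isGloballyMinimal_c794a1;
    haveI : NeZero (((⟨1, 0, 1, -3, 2⟩ : WeierstrassCurve ℤ).map (Int.castRingHom ℚ)).conductorNorm ℤ) :=
      neZero_conductorNorm_of_isElliptic _;
    ∀ (Dt : ModularParametrizationData ((⟨1, 0, 1, -3, 2⟩ : WeierstrassCurve ℤ).map (Int.castRingHom ℚ))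
        (((⟨1, 0, 1, -3, 2⟩ : WeierstrassCurve ℤ).map (Int.castRingHom ℚ)).conductorNorm ℤ)) (β : ℤ)
      (ι : K →+* ℂ) (d : KolyvaginHeegnerData Dt β ι 89),
    d.kolyvaginClass (p := 5) (by norm_num) 1 ≠ 0 →
    ((⟨1, 0, 1, -3, 2⟩ : WeierstrassCurve ℤ).map (Int.castRingHom ℚ)).shaCorank 5 = 0 ∧
      ((⟨1, 0, 1, -3, 2⟩ : WeierstrassCurve ℤ).map (Int.castRingHom ℚ)).mordellWeilRank = 2 ∧
      (((⟨1, 0, 1, -3, 2⟩ : WeierstrassCurve ℤ).map (Int.castRingHom ℚ)).quadraticTwist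
        ((-23 : ℤ) : ℚ)).mordellWeilRank ≤ 1 ∧
      (∀ P : ((⟨1, 0, 1, -3, 2⟩ : WeierstrassCurve ℤ).map (Int.castRingHom ℚ)).toAffine.Point,
        5 • P = 0 → P = 0) ∧
      (∀ x ∈ ((⟨1, 0, 1, -3, 2⟩ : WeierstrassCurve ℤ).map (Int.castRingHom ℚ)).sha, 5 • x = 0 → x = 0) ∧
      Nat.card ↥(selmerGroup ((⟨1, 0, 1, -3, 2⟩ : WeierstrassCurve ℤ).map (Int.castRingHom ℚ))
        ((5 : ℕ) : ℤ)) = 5 ^ 2 := by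
  haveI := isElliptic_c794a1
  haveI := isGloballyMinimal_c794a1
  haveI : NeZero (((⟨1, 0, 1, -3, 2⟩ : WeierstrassCurve ℤ).map (Int.castRingHom ℚ)).conductorNorm ℤ) :=
    neZero_conductorNorm_of_isElliptic _
  intro Dt β ι d hne
  haveI := Fact.mk (by norm_num : Nat.Prime 5)
  exact depthRow_print_of_datum_of_intModel_certificate intModel h372 not_hasCM
    KernelCerts002.C794a1.two_le_rank 5 (by norm_num) hasSurjectiveModNGaloisRep_pow_5 K hK hD
    (by norm_num) (by norm_num) heegner_neg23 89 (by norm_num) (by norm_num) (by decide +kernel)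
    (by norm_num) (by norm_num) (by norm_num) (by norm_num) (n := 90) card_89 (by norm_num)
    (Δ₀ := -1588) (by decide +kernel) (B := 11) (by decide +kernel) (by decide +kernel)
    (fun _ _ ↦ Or.inl (by norm_num)) Dt β ι d hne

end C794a1

namespace C817a1

/-- **DEPTH-TABLE ROW`817a1`, `(p, d_K, ℓ) = (5, -8, 239)`, ON PRINT-STANDARD INPUTS — no McCallum leaf,
no structure theorem, no twist point, no system (bit at ANY datum).** For `E = 817a1`, ANY imaginary
quadratic `K` with `d_K = -8`, any frame `(Dt, β, ι)` and ANY single Kolyvagin–Heegner datum `d` of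
conductor `239`, granted the ONE Literature fact (γ) = `GrossLMS1991.prop37_2_frobeniusCongruence`
(Gross 1991 Prop. 3.7 (2), the Eichler–Shimura congruence for Heegner points; cite-only): IF
`d.kolyvaginClass _ 1 ≠ 0` (the row's bit), THEN `corank_{ℤ_5} Ш(E)[5^∞] = 0`, `rank_ℤ E(ℚ) = 2`,
`rank_ℤ E^{(-8)}(ℚ) ≤ 1`, `E(ℚ)[5] = 0`, `Ш(E/ℚ)[5] = 0` and `#Sel^(5)(E/ℚ) = 5²` — the twin of
`C817a1.depthRow_5_neg8_239_ofDatum` with its FIVE named McCallum / Gross leaves (`h54 h43 h44 h53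
h22`) DELETED: the sign law, Lemma 5.3 and Prop. 2.2 are tree theorems (`…LeafSign`,
`…LeafEigenLine`, `…LeafReciprocity`), Lemma 4.3 is proved on the Kodaira–Néron cell / taken from F1
(`…LeafLocal`), Prop. 4.4 comes from (γ) (`JET.prop44_of_frobeniusCongruence`); the Kodaira–Néron
side condition (KN_5) `5 ∤ ord_v(Δ_min)` at the multiplicative places is CERTIFIED IN THE KERNEL
from `Δ(E₀) = -15523` (`decide`-able table of `depthRow_print_of_datum_of_intModel_certificate`),
the additive clause is void (`5 ≠ 3`). Every other side condition is a kernel theorem of the tree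
(g2–g7 certificates). CONDITIONAL on (γ) and the bit; per-curve; BSD is not proved by it. [cite:
Kolyvagin1991MathAnn, Thm. 2.3] [cite: GrossLMS1991, Prop. 3.7 (2), §5 (5.1), Prop. 6.2 (1)] [cite:
McCallumLMS1991, §§2–5] [cite: JetchevLauterStein2009, §3.6 (arXiv:0707.0032)] -/
theorem depthRow_5_neg8_239_print
    (h372 : GrossLMS1991.prop37_2_frobeniusCongruence)
    (K : Type) [Field K] [NumberField K] (hK : IsImaginaryQuadratic K)
    (hD : NumberField.discr K = -8) :
    haveI := isElliptic_c817a1;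
    haveI := isGloballyMinimal_c817a1;
    haveI : NeZero (((⟨0, 1, 1, 1, 6⟩ : WeierstrassCurve ℤ).map (Int.castRingHom ℚ)).conductorNorm ℤ) :=
      neZero_conductorNorm_of_isElliptic _;
    ∀ (Dt : ModularParametrizationData ((⟨0, 1, 1, 1, 6⟩ : WeierstrassCurve ℤ).map (Int.castRingHom ℚ))
        (((⟨0, 1, 1, 1, 6⟩ : WeierstrassCurve ℤ).map (Int.castRingHom ℚ)).conductorNorm ℤ)) (β : ℤ)
      (ι : K →+* ℂ) (d : KolyvaginHeegnerData Dt β ι 239),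
    d.kolyvaginClass (p := 5) (by norm_num) 1 ≠ 0 →
    ((⟨0, 1, 1, 1, 6⟩ : WeierstrassCurve ℤ).map (Int.castRingHom ℚ)).shaCorank 5 = 0 ∧
      ((⟨0, 1, 1, 1, 6⟩ : WeierstrassCurve ℤ).map (Int.castRingHom ℚ)).mordellWeilRank = 2 ∧
      (((⟨0, 1, 1, 1, 6⟩ : WeierstrassCurve ℤ).map (Int.castRingHom ℚ)).quadraticTwist
        ((-8 : ℤ) : ℚ)).mordellWeilRank ≤ 1 ∧
      (∀ P : ((⟨0, 1, 1, 1, 6⟩ : WeierstrassCurve ℤ).map (Int.castRingHom ℚ)).toAffine.Point,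
        5 • P = 0 → P = 0) ∧
      (∀ x ∈ ((⟨0, 1, 1, 1, 6⟩ : WeierstrassCurve ℤ).map (Int.castRingHom ℚ)).sha, 5 • x = 0 → x = 0) ∧
      Nat.card ↥(selmerGroup ((⟨0, 1, 1, 1, 6⟩ : WeierstrassCurve ℤ).map (Int.castRingHom ℚ))
        ((5 : ℕ) : ℤ)) = 5 ^ 2 := by
  haveI := isElliptic_c817a1
  haveI := isGloballyMinimal_c817a1
  haveI : NeZero (((⟨0, 1, 1, 1, 6⟩ : WeierstrassCurve ℤ).map (Int.castRingHom ℚ)).conductorNorm ℤ) :=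
    neZero_conductorNorm_of_isElliptic _
  intro Dt β ι d hne
  haveI := Fact.mk (by norm_num : Nat.Prime 5)
  exact depthRow_print_of_datum_of_intModel_certificate intModel h372 not_hasCM
    KernelCertsR01.C817a1.two_le_rank 5 (by norm_num) hasSurjectiveModNGaloisRep_pow_5 K hK hD
    (by norm_num) (by norm_num) heegner_neg8 239 (by norm_num) (by norm_num) (by decide +kernel)
    (by norm_num) (by norm_num) (by norm_num) (by norm_num) (n := 240) card_239 (by norm_num)
    (Δ₀ := -15523) (by decide +kernel) (B := 11) (by decide +kernel) (by decide +kernel)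
    (fun _ _ ↦ Or.inl (by norm_num)) Dt β ι d hne

end C817a1

namespace C997b1

/-- **DEPTH-TABLE ROW`997b1`, `(p, d_K, ℓ) = (5, -52, 199)`, ON PRINT-STANDARD INPUTS — no McCallum
leaf, no structure theorem, no twist point, no system (bit at ANY datum).** For `E = 997b1`, ANY
imaginary quadratic `K` with `d_K = -52`, any frame `(Dt, β, ι)` and ANY single Kolyvagin–Heegner
datum `d` of conductor `199`, granted the ONE Literature fact (γ) =
`GrossLMS1991.prop37_2_frobeniusCongruence` (Gross 1991 Prop. 3.7 (2), the Eichler–Shimura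
congruence for Heegner points; cite-only): IF `d.kolyvaginClass _ 1 ≠ 0` (the row's bit), THEN
`corank_{ℤ_5} Ш(E)[5^∞] = 0`, `rank_ℤ E(ℚ) = 2`, `rank_ℤ E^{(-52)}(ℚ) ≤ 1`, `E(ℚ)[5] = 0`,
`Ш(E/ℚ)[5] = 0` and `#Sel^(5)(E/ℚ) = 5²` — the twin of `C997b1.depthRow_5_neg52_199_ofDatum` with
its FIVE named McCallum / Gross leaves (`h54 h43 h44 h53 h22`) DELETED: the sign law, Lemma 5.3 and
Prop. 2.2 are tree theorems (`…LeafSign`, `…LeafEigenLine`, `…LeafReciprocity`), Lemma 4.3 is proved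
on the Kodaira–Néron cell / taken from F1 (`…LeafLocal`), Prop. 4.4 comes from (γ)
(`JET.prop44_of_frobeniusCongruence`); the Kodaira–Néron side condition (KN_5) `5 ∤ ord_v(Δ_min)` at
the multiplicative places is CERTIFIED IN THE KERNEL from `Δ(E₀) = 997` (`decide`-able table of
`depthRow_print_of_datum_of_intModel_certificate`), the additive clause is void (`5 ≠ 3`). Every
other side condition is a kernel theorem of the tree (g2–g7 certificates). CONDITIONAL on (γ) and
the bit; per-curve; BSD is not proved by it. [cite: Kolyvagin1991MathAnn, Thm. 2.3] [cite:
GrossLMS1991, Prop. 3.7 (2), §5 (5.1), Prop. 6.2 (1)] [cite: McCallumLMS1991, §§2–5] [cite: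
JetchevLauterStein2009, §3.6 (arXiv:0707.0032)] -/
theorem depthRow_5_neg52_199_print
    (h372 : GrossLMS1991.prop37_2_frobeniusCongruence)
    (K : Type) [Field K] [NumberField K] (hK : IsImaginaryQuadratic K)
    (hD : NumberField.discr K = -52) :
    haveI := isElliptic_c997b1;
    haveI := isGloballyMinimal_c997b1;
    haveI : NeZero (((⟨0, -1, 1, -5, -3⟩ : WeierstrassCurve ℤ).map (Int.castRingHom ℚ)).conductorNorm ℤ) :=
      neZero_conductorNorm_of_isElliptic _;
    ∀ (Dt : ModularParametrizationData ((⟨0, -1, 1, -5, -3⟩ : WeierstrassCurve ℤ).map (Int.castRingHom ℚ))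
        (((⟨0, -1, 1, -5, -3⟩ : WeierstrassCurve ℤ).map (Int.castRingHom ℚ)).conductorNorm ℤ)) (β : ℤ)
      (ι : K →+* ℂ) (d : KolyvaginHeegnerData Dt β ι 199),
    d.kolyvaginClass (p := 5) (by norm_num) 1 ≠ 0 →
    ((⟨0, -1, 1, -5, -3⟩ : WeierstrassCurve ℤ).map (Int.castRingHom ℚ)).shaCorank 5 = 0 ∧
      ((⟨0, -1, 1, -5, -3⟩ : WeierstrassCurve ℤ).map (Int.castRingHom ℚ)).mordellWeilRank = 2 ∧
      (((⟨0, -1, 1, -5, -3⟩ : WeierstrassCurve ℤ).map (Int.castRingHom ℚ)).quadraticTwist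
        ((-52 : ℤ) : ℚ)).mordellWeilRank ≤ 1 ∧
      (∀ P : ((⟨0, -1, 1, -5, -3⟩ : WeierstrassCurve ℤ).map (Int.castRingHom ℚ)).toAffine.Point,
        5 • P = 0 → P = 0) ∧
      (∀ x ∈ ((⟨0, -1, 1, -5, -3⟩ : WeierstrassCurve ℤ).map (Int.castRingHom ℚ)).sha, 5 • x = 0 → x = 0) ∧
      Nat.card ↥(selmerGroup ((⟨0, -1, 1, -5, -3⟩ : WeierstrassCurve ℤ).map (Int.castRingHom ℚ))
        ((5 : ℕ) : ℤ)) = 5 ^ 2 := by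
  haveI := isElliptic_c997b1
  haveI := isGloballyMinimal_c997b1
  haveI : NeZero (((⟨0, -1, 1, -5, -3⟩ : WeierstrassCurve ℤ).map (Int.castRingHom ℚ)).conductorNorm ℤ) :=
    neZero_conductorNorm_of_isElliptic _
  intro Dt β ι d hne
  haveI := Fact.mk (by norm_num : Nat.Prime 5)
  exact depthRow_print_of_datum_of_intModel_certificate intModel h372 not_hasCM
    KernelCertsR01.C997b1.two_le_rank 5 (by norm_num) hasSurjectiveModNGaloisRep_pow_5 K hK hD
    (by norm_num) (by norm_num) heegner_neg52 199 (by norm_num) (by norm_num) (by decide +kernel)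
    (by norm_num) (by norm_num) (by norm_num) (by norm_num) (n := 205) card_199 (by norm_num)
    (Δ₀ := 997) (by decide +kernel) (B := 11) (by decide +kernel) (by decide +kernel)
    (fun _ _ ↦ Or.inl (by norm_num)) Dt β ι d hne

end C997b1

end Summit.BirchSwinnertonDyer.BirchSwinnertonDyer.Theorems.KolyvaginDepthDoor

end
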